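import Literature.MathematicalPhysics.QuantumFieldTheory.Balaban1983to89.Node00.OpsYSectEElimStar

/-!
# `Balaban1983to89.B9PinMemberPivotExact` — T. Bałaban, *Propagators for lattice gauge theories in a background field*, Commun. Math. Phys. **99**
# (1985) 389–434 [Balaban1985BackgroundPropagators], Sect. E p. 428 *«(CB)(b₀) is equal to a solution of the equation (QB)(c) = 0, considered as an
# equation on the variable B(b₀)»*, with [5] = *Averaging operations for lattice gauge theories*, CMP **98** (1985) 17–51 [Balaban1985Averaging] (14) p. 19,
# (125) p. 36: **THE PIVOT COEFFICIENT OF THAT EQUATION IS EXACTLY A HOLONOMY CONJUGATION** — `K_c(V) = L^{−(d+1)}·Ad V([c₋, b₀(c)₋])` at every corner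
# whose source block carries its comb — hence a unit for EVERY background, with no smallness

statement-level companion of published sources with citation tags; every declaration here is a theorem; nothing here is a claim about the Yang–Mills mass gap.

HONEST FRAMING: count-neutral kernel algebra of NODE 00's Sect. E dictionary (`Node00.OpsYSectEElim ∕ …ElimStar`); a located SIMPLIFICATION (two small-field ∕
small-curvature regimes of record are idle for the invertibility of the pivot coefficients at source corners) and a located DICTIONARY POINT (the star corners with
a bad source block); nothing of node N06 ∕ [5] asserted; no (3.24) door assembled here; IDENT `h324c` NOT made; N06 ∕ N08 NOT discharged; nothing continuum ∕
ℝ⁴ ∕ OS ∕ mass gap ∕ Clay.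

WHY THIS FILE (cell `pub-ymgap`, D-0062; seat dag-n08-b gen 39, CLAIM-25 ∕ INTENT-25).  The (3.24) precision door of record at NODE 00's star letters, general
background (`…PrecisionDoorOnLambdaStarSmall`, p704589; n08-d p705447) displays a SMALL-FIELD regime of the averaged field `V` — `‖V(b) − 1‖ ≤ δ_V` on EVERY unit
bond, `L^{d+1}·2δ_V(L + (d+1)ℓ) < 1` — solely to make the pivot coefficients `K_c(V) = KstY`, `K_c(V)* = KTstY` of the bond elimination `C(V)` of (3.157) units
(`Node00.OpsYSectEElimStarSmall`, Neumann series) and to bound `‖K_c(V)⁻¹‖` (`…ERowsAtNode00StarSmall`); print's regime (3.35) is small CURVATURE, and print asks NO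
smallness at all for `C` (p. 428).  THIS FILE computes `K_c(V)` EXACTLY from the definitions (`Q1Y_apply`, `uΓ`, `usegY`, `B9Eq3169Comb.comb`):

* §0 plumbing — `hol` of a concatenation ∕ of a mapped list; the transported sum `trSum` and its transpose `trSumT` along a list `(range n).map f` as index sums;
  ★ THE LOAD-BEARING GEOMETRIC FACT OF §2 (node00-def-Y RULING-25 (iv): the one place to check): THE COMB OF AN AXIS POINT IS THE STRAIGHT SEGMENT
  (`comb_axis`: `Γ_{y, y + j·e_μ} = [y, y + j·e_μ]` — the least-moving-direction rule of [5] p. 24 ∕ [B5] (1.7) never leaves direction `μ`), carried to NODE 00's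
  carrier as `map_ubondOfIdx_uΓ_axis` (the unit-bond image of `uΓ` at an axis point of a GOOD corner block) and consumed once, in `hol_uΓ_hol_seg_eq_hol_line`.
* §1 ★★ THE MASTER FORMULA at EVERY corner `c = (y, μ)` and EVERY background: of the `L·L^{d+1}` (segment, bond) readings of `(Q(V)·)(c)` exactly the `L`
  segments of the axis of `c` read the pivot `b₀(c) = ⟨y + (L−1)e_μ, μ⟩` (`OpsYSectEElim.ofZ_add_eq_upivU_src_iff`), the segment from `z_j = y + j·e_μ` through its
  bond `s = L−1−j`, carrying the transport `R(V(Γ_{y,z_j}))·R(V([z_j, b₀₋]))`: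
  `(Q(V)(δ_{b₀(c)} ⊗ a))(c) = L^{−(d+2)} Σ_{s<L} R(V(Γ_{y,z_{L−1−s}})) R(V([z_{L−1−s}, b₀₋])) a` (`Q1Y_single_upivU_eq_sum`), and the transposed readings
  `(Q(V)* v)(b₀(c)) = L^{−(d+2)} Σ_{s<L} (R(V(Γ_{y,z_{L−1−s}})) R(V([z_{L−1−s}, b₀₋])))⁻¹ v` (`Q1TY_apply_upivU_eq_sum`).
* §2 ★★★ GOOD SOURCE BLOCK (all of `CBondY`; the `CBondStY` with `GoodY c₋`): the comb `Γ_{y,z_j}` IS `[y, z_j]`, so EVERY reading carries the SAME transport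
  `R(V([y, b₀₋]))` — **`K_c(V) a = L^{−(d+1)}·R(V([c₋, b₀(c)₋])) a`** (`KY_eq_smul_hol`, `KstY_eq_smul_hol_of_goodY`) and **`K_c(V)* v = L^{−(d+1)}·R(V([c₋,
  b₀(c)₋]))⁻¹ v`** (`KTY_eq_smul_hol_symm`, `KTstY_eq_smul_hol_symm_of_goodY`), for EVERY `U`; hence ★★★ `isUnit_KY ∕ isUnit_KTY ∕ isUnit_KstY_of_goodY ∕
  isUnit_KTstY_of_goodY` with NO hypothesis on the background, the explicit inverses `inverse_KY_apply ∕ inverse_KTY_apply` (`L^{d+1}·R(V(…))^{∓1}`), the sharp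
  norms `‖K_c(V)⁻¹ a‖ ≤ L^{d+1}‖a‖`, `‖(K_c(V)*)⁻¹ v‖ ≤ L^{d+1}‖v‖` for contraction-valued `V` (`norm_inverse_KY_apply_le`, …: n08-d's `κ_K = (1−κ)⁻¹` is `1`), and
  FILE 13's ∕ part 3's faces at EVERY background: `Q1Y_elimCY_all`, `elimCY_eq_self_of_constraints_all`, `sum_tr_elimCY_mul_all` (source convention, hypothesis-free).
* §3 THE LOCATED DICTIONARY POINT — star corners with a BAD source block («dictionary deviation of NODE 00: transport comb empty off `Λ′`», node00-def-Y
  RULING-25 (ii), pub-ymgap bus 2026-08-29): there `Node00.OpsYSectELetters.uΓ = []` (`uΓ_of_not_good`; the dictionary uses ONE list for the transport comb of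
  [5] (14) ∕ (125) AND for the axial tree set `IsAxialY` of (3.156) ∕ the contours of (3.169) — print-exact wherever NODE 00's own sector reads `Q(V)` (`c ∈ Λ′`),
  while print's (125) carries the comb `Γ_{c₋,x}` of EVERY block at which `Q` is read), so `K_c(V) a = L^{−(d+2)} Σ_{s<L} R(V([y + (L−1−s)e_μ, b₀₋])) a` is an
  AVERAGE of `L` partial-line conjugations (`KstY_eq_sum_of_not_goodY`, keyed to `uΓ_of_not_good` so that a transport-comb edition supersedes it by one
  rewrite) — not a unit in general (in `M₂(ℂ)`, `L = 2`, `V = diag(i, −i)` on the one line bond, `Ad V + 1` annihilates the off-diagonal directions): a CORRECT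
  CONSEQUENCE OF THE DICTIONARY, not of print.  Under the dictionary the small-field hypothesis is therefore the honest row there, but only on the `L − 1` line
  bonds `[c₋, b₀(c)₋] ⊂ B(c₋)`: ★★ `isUnit_KstY_of_small_on_line` ∕ `isUnit_KTstY_of_small_on_line` (`‖V(b) − 1‖ ≤ δ` on those bonds, `(L−1)·2δ < 1`,
  contraction-valued `V`), sharpening `OpsYSectEElimStarSmall.isUnit_K[T]stY_of_smallVY` (all unit bonds, `L^{d+1}·2δ(L + (d+1)ℓ) < 1`).  With print's comb on
  `B(c₋)` the coefficient would again be the exact conjugation of §2 (node00-def-Y's booked `uΓtr` edition «V-TR», RULING-25 (iii); not typed here).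
* §4 at the record (`M_N(ℂ)`, `V = avYOfRecord x U`): the v6 Sect. E letters' three faces at EVERY background (`…sectEYOfRecordV6_all`), and for `G ≤ U(N)` the
  pivot-inverse rows `‖K_c(V)⁻¹ a‖ ≤ L^{d+1}‖a‖` (source corners; star corners with a good source block: `star_pivot_rows_avYOfRecord_of_goodY`).  This file is
  RECORD-LETTER-FREE (no `lettersYOfRecordV4[P]`, no `G′`): dag-n08-d's CHECK-M (record ∕ `G′`-units) does not touch it.

CONSUMERS BY NAME.  `Node00.OpsYSectEElim`: `Q1Y_elimCY (hK)`, `elimCY_eq_self_of_constraints (hK)`, `sum_tr_elimCY_mul (hK) (hKT)` — discharged here at every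
`U` (§2), superseding for invertibility `OpsYSectEElimSmall` §2–§5 (`isUnit_KY_of_small ∕ _of_smallVY ∕ _of_ugauge_smallVY`) and `OpsYSectEElimAxial` §4–§5
(`isUnit_KY_KTY_of_plaqSmall`); `Node00.OpsYSectEElimStar`: `Q1Y_elimCstY ∕ elimCstY_eq_self_of_constraints ∕ sum_tr_elimCstY_mul` at the good-source star corners;
the star door of record (`…PrecisionDoorOnLambdaStar` §4 `hK ∕ hKT ∕ hKinv`) at those corners; at the bad-source star corners `isUnit_KstY_of_small_on_line` confines
the displayed smallness to the pivot lines.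

## Honest margins
(i) Nothing here changes a definition: the objects are node00-def-Y's `Q1Y ∕ KY ∕ KTY ∕ KstY ∕ KTstY ∕ uΓ ∕ usegY` verbatim; the bad-source formula of §3 is a
property OF THAT DICTIONARY (print's `Q` with combs on every block has the exact conjugation at every star corner).
(ii) `U1`-valued (contraction) fields only for the norm statements, as in `OpsYSectEElimSmall`; the algebraic identities hold for every `𝔳 : AvY 𝔸 x`, every `U`.
(iii) Nothing here touches `D2J`, `G̃₂`, the (2.153) ∕ `γ₀` row, (3.158)–(3.185), or any door; no continuum statement.
Net new unproved facts: 0.  Filed by seat dag-n08-b (gen 39) in its own namespace, BY NAME over node00-def-Y's parts 1–3 (nothing re-declared).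
-/

noncomputable section

namespace Literature.MathematicalPhysics.QuantumFieldTheory.Balaban1983to89.B9PinMemberPivotExact

open Literature.MathematicalPhysics.QuantumFieldTheory
open Literature.MathematicalPhysics.QuantumFieldTheory.Balaban1983to89.Node00
open B9Eq3169Mu
open B9Eq39Adjoint (R R_one)
open B9PinMembersKLevelV1 (MemberY)
open B6Elimination (corner mem_block corner_eq_of_mem_block)
open B6GlobalChartV1 (PV domT)
open B6BondElimination (unitVec unitVec_apply)
open B9Eq3169Comb (comb comb_of_ne_corner comb_of_eq_corner dir dir_spec pred)

variable {d ℓ : ℕ} {hd : 1 ≤ d + 1} {hL : Odd (ℓ + 1) ∧ 1 < ℓ + 1} {b₀ b₁ : ℝ} {Mstar : ℕ}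

/-! ## §0 Plumbing: transports along concatenated ∕ mapped lists, index sums for `trSum` ∕ `trSumT`, the comb of an axis point -/

section Lists

variable {Bond Bond' 𝔤 : Type} [AddCommGroup 𝔤] [Module ℝ 𝔤]

/-- `R(V(Γ₁Γ₂)) = R(V(Γ₁))R(V(Γ₂))`. [cite: Balaban1985BackgroundPropagators, p.390 («R(U(Γ))»), bookkeeping] -/
theorem hol_append_apply (T : Bond → 𝔤 ≃ₗ[ℝ] 𝔤) : ∀ (Γ₁ Γ₂ : List Bond) (v : 𝔤), hol T (Γ₁ ++ Γ₂) v = hol T Γ₁ (hol T Γ₂ v)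
  | [], _, _ => rfl
  | b :: Γ₁, Γ₂, v => by rw [List.cons_append, hol_cons_apply, hol_cons_apply, hol_append_apply T Γ₁ Γ₂ v]

/-- transports read through a relabelling of the bonds transport along the relabelled chain. [cite: Balaban1985BackgroundPropagators, (3.168) p.430, bookkeeping] -/
theorem hol_comp_apply (T : Bond → 𝔤 ≃ₗ[ℝ] 𝔤) (g : Bond' → Bond) : ∀ (Γ : List Bond') (v : 𝔤), hol (fun q => T (g q)) Γ v = hol T (Γ.map g) v
  | [], _ => rfl
  | b :: Γ, v => by rw [List.map_cons, hol_cons_apply, hol_cons_apply, hol_comp_apply T g Γ v]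

/-- **THE TRANSPORTED SUM ALONG `[f 0, …, f (n−1)]` AS AN INDEX SUM**: `Σ_{s<n} R(V(f 0))⋯R(V(f (s−1))) B(f s)`. [cite: Balaban1985BackgroundPropagators, (3.169) p.430; Balaban1985Averaging, (125) p.36, bookkeeping] -/
theorem trSum_range_map (T : Bond → 𝔤 ≃ₗ[ℝ] 𝔤) (B : Bond → 𝔤) (f : ℕ → Bond) :
    ∀ n : ℕ, trSum T B ((List.range n).map f) = ∑ s ∈ Finset.range n, hol T ((List.range s).map f) (B (f s))
  | 0 => by simp
  | n + 1 => by
      rw [List.range_succ, List.map_append, List.map_singleton, trSum_append, trSum_singleton, trSum_range_map T B f n,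
        Finset.sum_range_succ]

variable [DecidableEq Bond]

/-- the transpose of a transported sum over a concatenation: the second piece receives the test value pulled back along the first.
[cite: Balaban1985BackgroundPropagators, (3.169) p.430, (3.9) p.391, bookkeeping] -/
theorem trSumT_append {𝔤' : Type} [NormedAddCommGroup 𝔤'] [NormedSpace ℝ 𝔤'] (S : Bond → 𝔤' ≃ₗ[ℝ] 𝔤') :
    ∀ (Γ₁ Γ₂ : List Bond) (w : 𝔤'), trSumT S (Γ₁ ++ Γ₂) w = trSumT S Γ₁ w + trSumT S Γ₂ ((hol (symmFam S) Γ₁).symm w)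
  | [], Γ₂, w => by simp
  | b :: Γ₁, Γ₂, w => by
      have e : (hol (symmFam S) (b :: Γ₁)).symm w = (hol (symmFam S) Γ₁).symm (S b w) := by
        show ((hol (symmFam S) Γ₁).trans (symmFam S b)).symm w = _
        rw [LinearEquiv.symm_trans_apply]
        show (hol (symmFam S) Γ₁).symm (((S b).symm).symm w) = _
        rw [LinearEquiv.symm_symm]
      rw [List.cons_append, trSumT_cons, trSumT_cons, trSumT_append S Γ₁ Γ₂ (S b w), e, add_assoc]

/-- **THE TRANSPOSED READINGS ALONG `[f 0, …, f (n−1)]` AT A BOND AS AN INDEX SUM**: `Σ_{s<n, f s = q} (R(V(f 0))⋯R(V(f (s−1))))⁻¹ w`.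
[cite: Balaban1985BackgroundPropagators, (3.169) p.430, (3.9) p.391; Balaban1985Averaging, (125) p.36, bookkeeping] -/
theorem trSumT_range_map_apply {𝔤' : Type} [NormedAddCommGroup 𝔤'] [NormedSpace ℝ 𝔤'] (S : Bond → 𝔤' ≃ₗ[ℝ] 𝔤') (f : ℕ → Bond) (q : Bond) :
    ∀ (n : ℕ) (w : 𝔤'), trSumT S ((List.range n).map f) w q =
      ∑ s ∈ Finset.range n, if q = f s then (hol (symmFam S) ((List.range s).map f)).symm w else 0
  | 0, w => by simp
  | n + 1, w => by
      rw [List.range_succ, List.map_append, List.map_singleton, trSumT_append, Pi.add_apply, trSumT_range_map_apply S f q n w,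
        Finset.sum_range_succ, trSumT_cons, trSumT_nil, Pi.add_apply, sglY_apply, Pi.zero_apply, add_zero]

end Lists

section NormLists

variable {𝔸 : Type} [NormedRing 𝔸] [NormedSpace ℝ 𝔸] {Bond : Type}

/-- transport along a contour whose bond transports contract and move values by at most `δ` each moves a value by at most `|Γ|·δ` (the hypotheses asked on
the bonds OF THE CONTOUR only). [cite: Balaban1985BackgroundPropagators, (3.35) p.397, (3.169) p.430, bookkeeping] -/
theorem norm_hol_sub_self_le_of_forall_mem (T : Bond → 𝔸 ≃ₗ[ℝ] 𝔸) (hT : ∀ b v, ‖T b v‖ ≤ ‖v‖) {δ : ℝ} :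
    ∀ (Γ : List Bond), (∀ b ∈ Γ, ∀ v, ‖T b v - v‖ ≤ δ * ‖v‖) → ∀ v : 𝔸, ‖hol T Γ v - v‖ ≤ Γ.length * δ * ‖v‖
  | [], _, v => by simp
  | b :: Γ, hδ, v => by
      rw [hol_cons_apply, List.length_cons]
      have e : T b (hol T Γ v) - v = T b (hol T Γ v - v) + (T b v - v) := by rw [map_sub]; abel
      rw [e]
      refine (norm_add_le _ _).trans ?_
      have h1 := (hT b _).trans (norm_hol_sub_self_le_of_forall_mem T hT Γ (fun b' hb' => hδ b' (List.mem_cons_of_mem b hb')) v)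
      have h2 := hδ b (by simp) v
      push_cast
      linarith

end NormLists

section Comb

variable {n L : ℕ}

/-- ★ **THE COMB OF AN AXIS POINT IS THE STRAIGHT SEGMENT** (THE load-bearing geometric fact of §2): for a corner `c₀` of the `L`-lattice and `j < L`,
`Γ_{c₀, c₀ + j·e_μ} = [⟨c₀, μ⟩, ⟨c₀ + e_μ, μ⟩, …, ⟨c₀ + (j−1)e_μ, μ⟩]` — the least-moving-direction rule of the comb ([5] p. 24: directions taken one after the
other, each segment straight) has only the direction `μ` to move in, since an axis point differs from its corner in the coordinate `μ` alone.
[cite: Balaban1985Averaging, p.24, (14) p.19; Balaban1984PropagatorsI, (1.7) p.18] -/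
theorem comb_axis (hL0 : 0 < L) {c₀ : Fin n → ℤ} (hc : corner L c₀ = c₀) (μ : Fin n) :
    ∀ j : ℕ, j < L → comb L (c₀ + (j : ℤ) • unitVec μ) = (List.range j).map fun i : ℕ => (c₀ + (i : ℤ) • unitVec μ, μ)
  | 0, _ => by
      rw [Nat.cast_zero, zero_smul, add_zero, List.range_zero, List.map_nil]
      exact comb_of_eq_corner hL0 hc.symm
  | j + 1, hj => by
      have hmem : c₀ + ((j + 1 : ℕ) : ℤ) • unitVec μ ∈ B6Elimination.block L (corner L c₀) := by
        rw [hc, mem_block]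
        intro i
        rw [Pi.add_apply, Pi.smul_apply, unitVec_apply, smul_eq_mul]
        by_cases hi : i = μ
        · rw [if_pos hi, mul_one]; constructor <;> push_cast <;> omega
        · rw [if_neg hi, mul_zero, add_zero]; constructor <;> omega
      have hcx : corner L (c₀ + ((j + 1 : ℕ) : ℤ) • unitVec μ) = c₀ := by rw [corner_eq_of_mem_block hL0 hmem, hc]
      have hne : c₀ + ((j + 1 : ℕ) : ℤ) • unitVec μ ≠ corner L (c₀ + ((j + 1 : ℕ) : ℤ) • unitVec μ) := by
        rw [hcx]
        intro e
        have e1 := congrFun e μ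
        rw [Pi.add_apply, Pi.smul_apply, unitVec_apply, if_pos rfl, smul_eq_mul, mul_one] at e1
        push_cast at e1
        omega
      have hdir : dir _ hne = μ := by
        by_contra h'
        apply dir_spec hne
        rw [congrFun hcx (dir _ hne), Pi.add_apply, Pi.smul_apply, unitVec_apply, if_neg h', smul_zero, add_zero]
      have hpred : pred _ hne = c₀ + (j : ℤ) • unitVec μ := by
        unfold pred
        rw [hdir]
        funext i
        simp only [Pi.add_apply, Pi.sub_apply, Pi.smul_apply, unitVec_apply, smul_eq_mul]
        split_ifs
        · push_cast; ring
        · ring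
      rw [comb_of_ne_corner hL0 hne, hdir, hpred, comb_axis hL0 hc μ j (Nat.lt_of_succ_lt hj), List.range_succ, List.map_append,
        List.map_singleton]

end Comb

/-! ## §1 The master formula: the readings of the pivot in `(Q(V)·)(c)` and in `(Q(V)*·)(b₀(c))`, every corner, every background -/

section Geometry

variable (x : MemberY d ℓ hd hL b₀ b₁ Mstar)

/-- the axis sites `y + t·e_μ`, `0 ≤ t ≤ L − 1`, of a corner `y` have the labels `labK y + t·e_μ`. [cite: Balaban1984PropagatorsI, (1.6) p.18, bookkeeping] -/
theorem labK_ofZ_axis {y : USiteY x} (hy : IsCornerY x y) (μ : Fin (d + 1)) {t : ℤ} (h0 : 0 ≤ t) (ht : t ≤ ℓ) :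
    labK x (ofZ x (labK x y + t • unitVec μ)) = labK x y + t • unitVec μ :=
  labK_ofZ x (inBox_of_mem_block x (add_smul_unitVec_mem_block x hy μ h0 ht))

/-- the axis parametrisation `t ↦ y + t·e_μ` is injective on `0 ≤ t ≤ L − 1`. [cite: Balaban1984PropagatorsI, (1.6) p.18, bookkeeping] -/
theorem ofZ_axis_inj {y : USiteY x} (hy : IsCornerY x y) (μ : Fin (d + 1)) {t t' : ℤ} (h0 : 0 ≤ t) (ht : t ≤ ℓ) (h0' : 0 ≤ t') (ht' : t' ≤ ℓ)
    (e : ofZ x (labK x y + t • unitVec μ) = ofZ x (labK x y + t' • unitVec μ)) : t = t' := by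
  have e1 := congrArg (labK x) e
  rw [labK_ofZ_axis x hy μ h0 ht, labK_ofZ_axis x hy μ h0' ht'] at e1
  have e2 := congrFun e1 μ
  simp only [Pi.add_apply, Pi.smul_apply, unitVec_apply, ite_true, smul_eq_mul, mul_one] at e2
  linarith

/-- ★ **THE UNIT-BOND IMAGE OF THE COMB `Γ_{y, y + j·e_μ}` OF A GOOD CORNER BLOCK IS THE STRAIGHT SEGMENT `[y, y + j·e_μ]`** (the dictionary's `uΓ` is the comb of
[5] p. 24 on `Λ′`; `comb_axis`). [cite: Balaban1985Averaging, p.24, (14) p.19; Balaban1985BackgroundPropagators, (3.169) p.430] -/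
theorem map_ubondOfIdx_uΓ_axis {y : USiteY x} (hy : IsCornerY x y) (hg : GoodY x y) (μ : Fin (d + 1)) {j : ℕ} (hj : j < ℓ + 1) :
    (uΓ x (ofZ x (labK x y + (j : ℤ) • unitVec μ))).map (ubondOfIdx x) =
      (List.range j).map fun i : ℕ => (⟨ofZ x (labK x y + (i : ℤ) • unitVec μ), μ⟩ : UBondY x) := by
  classical
  have hz : GoodY x (ofZ x (labK x y + (j : ℤ) • unitVec μ)) := goodY_of_mem_ublockY x hg (ofZ_add_mem_ublockY x hy μ (by positivity) (by omega))
  unfold uΓ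
  rw [dif_pos hz, List.map_pmap]
  simp only [ubondOfIdx_idxOfU]
  rw [List.pmap_eq_map, labK_ofZ_axis x hy μ (by positivity) (by omega), comb_axis ell_succ_pos ((isCornerY_iff x y).1 hy) μ j hj, List.map_map]
  rfl

end Geometry

section Master

variable {𝔸 : Type} [NormedRing 𝔸] [NormedAlgebra ℂ 𝔸] [CompleteSpace 𝔸]
variable (x : MemberY d ℓ hd hL b₀ b₁ Mstar) (𝔳 : AvY 𝔸 x)

/-- the transports of record over index bonds are the unit-bond transports read through `ubondOfIdx` — along every contour.
[cite: Balaban1985BackgroundPropagators, (3.168)–(3.169) p.430, bookkeeping] -/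
theorem hol_RVY_eq_hol_RUY_map (U : CfgY 𝔸 x.toKIdx) (Γ : List (IBondY x.toKIdx)) (v : 𝔸) :
    hol (RVY x 𝔳 U) Γ v = hol (RUY x 𝔳 U) (Γ.map (ubondOfIdx x)) v :=
  hol_comp_apply (RUY x 𝔳 U) (ubondOfIdx x) Γ v

/-- ★★ **THE MASTER FORMULA**: at a corner `c = (y, μ)`, for every background, the value of `(Q(V)(δ_{b₀(c)} ⊗ a))(c)` is `L^{−(d+2)}` times the sum over the
`L` axis segments of the transports `R(V(Γ_{y,z}))·R(V([z, b₀₋]))a`, `z = y + (L−1−s)e_μ` reading the pivot through its bond number `s` — every other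
(segment, bond) reading of (125) misses `b₀(c)`. [cite: Balaban1985Averaging, (125) p.36, (14) p.19; Balaban1985BackgroundPropagators, p.428 («exactly one bond b₀»)] -/
theorem Q1Y_single_upivU_eq_sum {y : USiteY x} (hy : IsCornerY x y) (μ : Fin (d + 1)) (h : (upivU x (y, μ)).src ∈ (domT x.hN x.D x.hk).Om x.k)
    (U : CfgY 𝔸 x.toKIdx) (a : 𝔸) :
    Q1Y x 𝔳 U (y, μ) (Pi.single (idxOfU x (upivU x (y, μ)) h) a) =
      qNormY d ℓ • ∑ s ∈ Finset.range (ℓ + 1),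
        hol (RVY x 𝔳 U) (uΓ x (ofZ x (labK x y + ((ℓ : ℤ) - s) • unitVec μ)))
          (hol (RUY x 𝔳 U) ((List.range s).map fun i : ℕ =>
            (⟨ofZ x (labK x (ofZ x (labK x y + ((ℓ : ℤ) - s) • unitVec μ)) + (i : ℤ) • unitVec μ), μ⟩ : UBondY x)) a) := by
  classical
  rw [Q1Y_apply]
  congr 1
  have hseg : ∀ z : USiteY x, trSum (RUY x 𝔳 U) (readUY x (Pi.single (idxOfU x (upivU x (y, μ)) h) a)) (usegY x z μ) =
      ∑ s ∈ Finset.range (ℓ + 1), if z = ofZ x (labK x y + ((ℓ : ℤ) - s) • unitVec μ) then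
        hol (RUY x 𝔳 U) ((List.range s).map fun i : ℕ => (⟨ofZ x (labK x z + (i : ℤ) • unitVec μ), μ⟩ : UBondY x)) a else 0 := by
    intro z
    rw [usegY, trSum_range_map]
    refine Finset.sum_congr rfl fun s hs => ?_
    rw [Finset.mem_range] at hs
    rw [readUY_single]
    have hiff : ((⟨ofZ x (labK x z + ((s : ℕ) : ℤ) • unitVec μ), μ⟩ : UBondY x) = upivU x (y, μ)) ↔ z = ofZ x (labK x y + ((ℓ : ℤ) - s) • unitVec μ) := by
      rw [← ofZ_add_eq_upivU_src_iff x hy z μ hs]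
      constructor
      · intro e; exact congrArg PBond.src e
      · intro e; exact congrArg (fun w => (⟨w, μ⟩ : UBondY x)) e
    by_cases hz : z = ofZ x (labK x y + ((ℓ : ℤ) - s) • unitVec μ)
    · rw [if_pos (hiff.2 hz), if_pos hz]
    · rw [if_neg (fun e => hz (hiff.1 e)), if_neg hz, map_zero]
  simp only [hseg, map_sum]
  rw [Finset.sum_comm]
  refine Finset.sum_congr rfl fun s hs => ?_
  rw [Finset.mem_range] at hs
  have hmem : ofZ x (labK x y + ((ℓ : ℤ) - s) • unitVec μ) ∈ ublockY x y := ofZ_add_mem_ublockY x hy μ (by omega) (by omega)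
  rw [Finset.sum_eq_single (ofZ x (labK x y + ((ℓ : ℤ) - s) • unitVec μ))]
  · rw [if_pos rfl]
  · intro z _ hz
    rw [if_neg hz, map_zero]
  · intro hne
    exact absurd hmem hne

/-- ★★ **THE MASTER FORMULA, TRANSPOSED**: the value at the pivot `b₀(c)` of `Q(V)* v` is `L^{−(d+2)}` times the sum over the `L` axis segments of the INVERSE
transports `(R(V(Γ_{y,z}))·R(V([z, b₀₋])))⁻¹ v`. [cite: Balaban1985Averaging, (125) p.36; Balaban1985BackgroundPropagators, p.428, (3.9) p.391] -/
theorem Q1TY_apply_upivU_eq_sum {y : USiteY x} (hy : IsCornerY x y) (μ : Fin (d + 1)) (h : (upivU x (y, μ)).src ∈ (domT x.hN x.D x.hk).Om x.k)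
    (U : CfgY 𝔸 x.toKIdx) (v : 𝔸) :
    Q1TY x 𝔳 U (y, μ) v (idxOfU x (upivU x (y, μ)) h) =
      qNormY d ℓ • ∑ s ∈ Finset.range (ℓ + 1),
        (hol (RUY x 𝔳 U) ((List.range s).map fun i : ℕ =>
            (⟨ofZ x (labK x (ofZ x (labK x y + ((ℓ : ℤ) - s) • unitVec μ)) + (i : ℤ) • unitVec μ), μ⟩ : UBondY x))).symm
          ((hol (RVY x 𝔳 U) (uΓ x (ofZ x (labK x y + ((ℓ : ℤ) - s) • unitVec μ)))).symm v) := by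
  classical
  rw [Q1TY_apply, Pi.smul_apply]
  congr 1
  unfold q1TFunY
  rw [Finset.sum_apply]
  simp only [placeUY_idxOfU]
  have hseg : ∀ (z : USiteY x) (w : 𝔸), trSumT (RUTY x 𝔳 U) (usegY x z μ) w (upivU x (y, μ)) =
      ∑ s ∈ Finset.range (ℓ + 1), if z = ofZ x (labK x y + ((ℓ : ℤ) - s) • unitVec μ) then
        (hol (RUY x 𝔳 U) ((List.range s).map fun i : ℕ => (⟨ofZ x (labK x z + (i : ℤ) • unitVec μ), μ⟩ : UBondY x))).symm w else 0 := by
    intro z w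
    rw [usegY, trSumT_range_map_apply (RUTY x 𝔳 U) _ (upivU x (y, μ)), symmFam_RUTY]
    refine Finset.sum_congr rfl fun s hs => ?_
    rw [Finset.mem_range] at hs
    have hiff : (upivU x (y, μ) = (⟨ofZ x (labK x z + ((s : ℕ) : ℤ) • unitVec μ), μ⟩ : UBondY x)) ↔ z = ofZ x (labK x y + ((ℓ : ℤ) - s) • unitVec μ) := by
      rw [← ofZ_add_eq_upivU_src_iff x hy z μ hs]
      constructor
      · intro e; exact (congrArg PBond.src e).symm
      · intro e; exact (congrArg (fun w => (⟨w, μ⟩ : UBondY x)) e).symm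
    by_cases hz : z = ofZ x (labK x y + ((ℓ : ℤ) - s) • unitVec μ)
    · rw [if_pos (hiff.2 hz), if_pos hz]
    · rw [if_neg (fun e => hz (hiff.1 e)), if_neg hz]
  simp only [hseg]
  rw [Finset.sum_comm]
  refine Finset.sum_congr rfl fun s hs => ?_
  rw [Finset.mem_range] at hs
  have hmem : ofZ x (labK x y + ((ℓ : ℤ) - s) • unitVec μ) ∈ ublockY x y := ofZ_add_mem_ublockY x hy μ (by omega) (by omega)
  rw [Finset.sum_eq_single (ofZ x (labK x y + ((ℓ : ℤ) - s) • unitVec μ))]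
  · rw [if_pos rfl]
  · intro z _ hz
    rw [if_neg hz]
  · intro hne
    exact absurd hmem hne

/-- ★★ **GOOD SOURCE BLOCK: EVERY READING OF THE PIVOT CARRIES THE SAME TRANSPORT `R(V([y, b₀₋]))`** — the comb to the axis point `z = y + (L−1−s)e_μ` is the
segment `[y, z]`, followed by `[z, b₀₋]`. [cite: Balaban1985Averaging, (14) p.19 («Γ_{c₋,x} ∪ [x, x(c)]»), p.24, (125) p.36] -/
theorem hol_uΓ_hol_seg_eq_hol_line {y : USiteY x} (hy : IsCornerY x y) (hg : GoodY x y) (μ : Fin (d + 1)) {s : ℕ} (hs : s < ℓ + 1)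
    (U : CfgY 𝔸 x.toKIdx) (a : 𝔸) :
    hol (RVY x 𝔳 U) (uΓ x (ofZ x (labK x y + ((ℓ : ℤ) - s) • unitVec μ)))
        (hol (RUY x 𝔳 U) ((List.range s).map fun i : ℕ =>
          (⟨ofZ x (labK x (ofZ x (labK x y + ((ℓ : ℤ) - s) • unitVec μ)) + (i : ℤ) • unitVec μ), μ⟩ : UBondY x)) a) =
      hol (RUY x 𝔳 U) ((List.range ℓ).map fun i : ℕ => (⟨ofZ x (labK x y + (i : ℤ) • unitVec μ), μ⟩ : UBondY x)) a := by
  have ej : ((ℓ : ℤ) - s) = ((ℓ - s : ℕ) : ℤ) := by omega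
  rw [hol_RVY_eq_hol_RUY_map, ej, map_ubondOfIdx_uΓ_axis x hy hg μ (j := ℓ - s) (by omega), labK_ofZ_axis x hy μ (by positivity) (by omega),
    ← hol_append_apply]
  have hr : List.range ℓ = List.range (ℓ - s) ++ (List.range s).map ((ℓ - s) + ·) := by
    rw [← List.range_add]; congr 1; omega
  have hl : ((List.range (ℓ - s)).map fun i : ℕ => (⟨ofZ x (labK x y + (i : ℤ) • unitVec μ), μ⟩ : UBondY x)) ++
      ((List.range s).map fun i : ℕ => (⟨ofZ x (labK x y + ((ℓ - s : ℕ) : ℤ) • unitVec μ + (i : ℤ) • unitVec μ), μ⟩ : UBondY x)) =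
      (List.range ℓ).map fun i : ℕ => (⟨ofZ x (labK x y + (i : ℤ) • unitVec μ), μ⟩ : UBondY x) := by
    rw [hr, List.map_append, List.map_map]
    congr 1
    apply List.map_congr_left
    intro i _
    simp only [Function.comp_apply, Nat.cast_add, add_smul, add_assoc]
  rw [hl]

/-- ★★★ **GOOD SOURCE BLOCK: `(Q(V)(δ_{b₀(c)} ⊗ a))(c) = L^{−(d+1)}·R(V([c₋, b₀(c)₋])) a`** for every background. [cite: Balaban1985Averaging, (125) p.36; Balaban1985BackgroundPropagators, p.428] -/
theorem Q1Y_single_upivU_of_goodY {y : USiteY x} (hy : IsCornerY x y) (hg : GoodY x y) (μ : Fin (d + 1))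
    (h : (upivU x (y, μ)).src ∈ (domT x.hN x.D x.hk).Om x.k) (U : CfgY 𝔸 x.toKIdx) (a : 𝔸) :
    Q1Y x 𝔳 U (y, μ) (Pi.single (idxOfU x (upivU x (y, μ)) h) a) =
      ((((ℓ + 1 : ℕ) : ℂ)) ^ (d + 1))⁻¹ • hol (RUY x 𝔳 U) ((List.range ℓ).map fun i : ℕ => (⟨ofZ x (labK x y + (i : ℤ) • unitVec μ), μ⟩ : UBondY x)) a := by
  rw [Q1Y_single_upivU_eq_sum x 𝔳 hy μ h U a]
  have hterm : ∀ s ∈ Finset.range (ℓ + 1),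
      hol (RVY x 𝔳 U) (uΓ x (ofZ x (labK x y + ((ℓ : ℤ) - s) • unitVec μ)))
          (hol (RUY x 𝔳 U) ((List.range s).map fun i : ℕ =>
            (⟨ofZ x (labK x (ofZ x (labK x y + ((ℓ : ℤ) - s) • unitVec μ)) + (i : ℤ) • unitVec μ), μ⟩ : UBondY x)) a) =
        hol (RUY x 𝔳 U) ((List.range ℓ).map fun i : ℕ => (⟨ofZ x (labK x y + (i : ℤ) • unitVec μ), μ⟩ : UBondY x)) a := fun s hs =>
    hol_uΓ_hol_seg_eq_hol_line x 𝔳 hy hg μ (Finset.mem_range.1 hs) U a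
  rw [Finset.sum_congr rfl hterm, Finset.sum_const, Finset.card_range, ← Nat.cast_smul_eq_nsmul ℂ, smul_smul, qNormY, pow_succ, mul_inv,
    inv_mul_cancel_right₀ (Nat.cast_ne_zero.2 (Nat.succ_ne_zero ℓ))]

/-- ★★★ **GOOD SOURCE BLOCK, TRANSPOSED: `(Q(V)* v)(b₀(c)) = L^{−(d+1)}·R(V([c₋, b₀(c)₋]))⁻¹ v`** for every background. [cite: Balaban1985Averaging, (125) p.36; Balaban1985BackgroundPropagators, p.428, (3.9) p.391] -/
theorem Q1TY_apply_upivU_of_goodY {y : USiteY x} (hy : IsCornerY x y) (hg : GoodY x y) (μ : Fin (d + 1))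
    (h : (upivU x (y, μ)).src ∈ (domT x.hN x.D x.hk).Om x.k) (U : CfgY 𝔸 x.toKIdx) (v : 𝔸) :
    Q1TY x 𝔳 U (y, μ) v (idxOfU x (upivU x (y, μ)) h) =
      ((((ℓ + 1 : ℕ) : ℂ)) ^ (d + 1))⁻¹ •
        (hol (RUY x 𝔳 U) ((List.range ℓ).map fun i : ℕ => (⟨ofZ x (labK x y + (i : ℤ) • unitVec μ), μ⟩ : UBondY x))).symm v := by
  rw [Q1TY_apply_upivU_eq_sum x 𝔳 hy μ h U v]
  have hterm : ∀ s ∈ Finset.range (ℓ + 1),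
      (hol (RUY x 𝔳 U) ((List.range s).map fun i : ℕ =>
            (⟨ofZ x (labK x (ofZ x (labK x y + ((ℓ : ℤ) - s) • unitVec μ)) + (i : ℤ) • unitVec μ), μ⟩ : UBondY x))).symm
          ((hol (RVY x 𝔳 U) (uΓ x (ofZ x (labK x y + ((ℓ : ℤ) - s) • unitVec μ)))).symm v) =
        (hol (RUY x 𝔳 U) ((List.range ℓ).map fun i : ℕ => (⟨ofZ x (labK x y + (i : ℤ) • unitVec μ), μ⟩ : UBondY x))).symm v := by
    intro s hs
    set eC := hol (RVY x 𝔳 U) (uΓ x (ofZ x (labK x y + ((ℓ : ℤ) - s) • unitVec μ))) with heC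
    set eS := hol (RUY x 𝔳 U) ((List.range s).map fun i : ℕ =>
      (⟨ofZ x (labK x (ofZ x (labK x y + ((ℓ : ℤ) - s) • unitVec μ)) + (i : ℤ) • unitVec μ), μ⟩ : UBondY x)) with heS
    set eL := hol (RUY x 𝔳 U) ((List.range ℓ).map fun i : ℕ => (⟨ofZ x (labK x y + (i : ℤ) • unitVec μ), μ⟩ : UBondY x)) with heL
    have hall : ∀ a, eC (eS a) = eL a := fun a => by rw [heC, heS, heL]; exact hol_uΓ_hol_seg_eq_hol_line x 𝔳 hy hg μ (Finset.mem_range.1 hs) U a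
    apply eL.injective
    rw [← hall, LinearEquiv.apply_symm_apply, LinearEquiv.apply_symm_apply, LinearEquiv.apply_symm_apply]
  rw [Finset.sum_congr rfl hterm, Finset.sum_const, Finset.card_range, ← Nat.cast_smul_eq_nsmul ℂ, smul_smul, qNormY, pow_succ, mul_inv,
    inv_mul_cancel_right₀ (Nat.cast_ne_zero.2 (Nat.succ_ne_zero ℓ))]

end Master

/-! ## §2 Good source block: `K_c(V)` and `K_c(V)*` ARE holonomy conjugations — units for every background, sharp inverses, the faces of (3.157) -/

section GoodSource

variable {𝔸 : Type} [NormedRing 𝔸] [NormedAlgebra ℂ 𝔸] [CompleteSpace 𝔸]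
variable (x : MemberY d ℓ hd hL b₀ b₁ Mstar) (𝔳 : AvY 𝔸 x)

/-- ★★★ **`K_c(V) = L^{−(d+1)}·Ad V([c₋, b₀(c)₋])` EXACTLY, EVERY BACKGROUND** (source convention: both end blocks good): the pivot coefficient of the
equation `(Q(V)B)(c) = 0` in `B(b₀(c))` is the conjugation by the transport along the straight line from the corner `c₋` to the pivot, times `L^{−(d+1)}`.
[cite: Balaban1985BackgroundPropagators, p.428 («considered as an equation on the variable B(b₀)»); Balaban1985Averaging, (125) p.36, (14) p.19] -/
theorem KY_eq_smul_hol (U : CfgY 𝔸 x.toKIdx) (c : CBondY x) (a : 𝔸) :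
    KY x 𝔳 U c a = ((((ℓ + 1 : ℕ) : ℂ)) ^ (d + 1))⁻¹ •
      hol (RUY x 𝔳 U) ((List.range ℓ).map fun i : ℕ => (⟨ofZ x (labK x c.1.1 + (i : ℤ) • unitVec c.1.2), c.1.2⟩ : UBondY x)) a := by
  obtain ⟨⟨y, μ⟩, hc⟩ := c
  have h := (mem_coarseY x).1 hc
  rw [KY_apply]
  exact Q1Y_single_upivU_of_goodY x 𝔳 h.1 h.2.1 μ _ U a

/-- ★★★ **`K_c(V)* = L^{−(d+1)}·(Ad V([c₋, b₀(c)₋]))⁻¹` EXACTLY, EVERY BACKGROUND** (source convention). [cite: Balaban1985BackgroundPropagators, p.428, (3.9) p.391; Balaban1985Averaging, (125) p.36] -/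
theorem KTY_eq_smul_hol_symm (U : CfgY 𝔸 x.toKIdx) (c : CBondY x) (v : 𝔸) :
    KTY x 𝔳 U c v = ((((ℓ + 1 : ℕ) : ℂ)) ^ (d + 1))⁻¹ •
      (hol (RUY x 𝔳 U) ((List.range ℓ).map fun i : ℕ => (⟨ofZ x (labK x c.1.1 + (i : ℤ) • unitVec c.1.2), c.1.2⟩ : UBondY x))).symm v := by
  obtain ⟨⟨y, μ⟩, hc⟩ := c
  have h := (mem_coarseY x).1 hc
  rw [KTY_apply]
  exact Q1TY_apply_upivU_of_goodY x 𝔳 h.1 h.2.1 μ _ U v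

/-- ★★★ **STAR CORNER WITH A GOOD SOURCE BLOCK: `K_c(V) = L^{−(d+1)}·Ad V([c₋, b₀(c)₋])` EXACTLY, EVERY BACKGROUND.**
[cite: Balaban1985BackgroundPropagators, p.428; Balaban1984PropagatorsII, Lemma 2.4 p.245 (star Λ); Balaban1985Averaging, (125) p.36] -/
theorem KstY_eq_smul_hol_of_goodY (U : CfgY 𝔸 x.toKIdx) (c : CBondStY x) (hg : GoodY x c.1.1) (a : 𝔸) :
    KstY x 𝔳 U c a = ((((ℓ + 1 : ℕ) : ℂ)) ^ (d + 1))⁻¹ •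
      hol (RUY x 𝔳 U) ((List.range ℓ).map fun i : ℕ => (⟨ofZ x (labK x c.1.1 + (i : ℤ) • unitVec c.1.2), c.1.2⟩ : UBondY x)) a := by
  obtain ⟨⟨y, μ⟩, hc⟩ := c
  have h := (mem_coarseStY x).1 hc
  rw [KstY_apply]
  exact Q1Y_single_upivU_of_goodY x 𝔳 h.1 hg μ _ U a

/-- ★★★ **STAR CORNER WITH A GOOD SOURCE BLOCK, TRANSPOSED: `K_c(V)* = L^{−(d+1)}·(Ad V([c₋, b₀(c)₋]))⁻¹` EXACTLY, EVERY BACKGROUND.**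
[cite: Balaban1985BackgroundPropagators, p.428, (3.9) p.391; Balaban1984PropagatorsII, Lemma 2.4 p.245] -/
theorem KTstY_eq_smul_hol_symm_of_goodY (U : CfgY 𝔸 x.toKIdx) (c : CBondStY x) (hg : GoodY x c.1.1) (v : 𝔸) :
    KTstY x 𝔳 U c v = ((((ℓ + 1 : ℕ) : ℂ)) ^ (d + 1))⁻¹ •
      (hol (RUY x 𝔳 U) ((List.range ℓ).map fun i : ℕ => (⟨ofZ x (labK x c.1.1 + (i : ℤ) • unitVec c.1.2), c.1.2⟩ : UBondY x))).symm v := by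
  obtain ⟨⟨y, μ⟩, hc⟩ := c
  have h := (mem_coarseStY x).1 hc
  rw [KTstY_apply]
  exact Q1TY_apply_upivU_of_goodY x 𝔳 h.1 hg μ _ U v

omit [CompleteSpace 𝔸] in
/-- an endomorphism that is a nonzero scalar times (the function of) a linear equivalence is a unit. [cite: Balaban1985BackgroundPropagators, p.428, bookkeeping] -/
theorem isUnit_of_eq_smul_equiv (K : Module.End ℂ 𝔸) (e : 𝔸 ≃ₗ[ℝ] 𝔸) {κ : ℂ} (hκ : κ ≠ 0) (hK : ∀ a, K a = κ • e a) : IsUnit K := by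
  rw [Module.End.isUnit_iff]
  constructor
  · intro a b hab
    rw [hK, hK] at hab
    have h2 := congrArg (fun v => κ⁻¹ • v) hab
    simp only [smul_smul, inv_mul_cancel₀ hκ, one_smul] at h2
    exact e.injective h2
  · intro b
    refine ⟨e.symm (κ⁻¹ • b), ?_⟩
    rw [hK, LinearEquiv.apply_symm_apply, smul_smul, mul_inv_cancel₀ hκ, one_smul]

omit [CompleteSpace 𝔸] in
/-- the inverse of such an endomorphism is `κ⁻¹` times the inverse equivalence. [cite: Balaban1985BackgroundPropagators, p.428, bookkeeping] -/
theorem inverse_apply_of_eq_smul_equiv (K : Module.End ℂ 𝔸) (e : 𝔸 ≃ₗ[ℝ] 𝔸) {κ : ℂ} (hκ : κ ≠ 0) (hK : ∀ a, K a = κ • e a)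
    (he : ∀ (c : ℂ) (v : 𝔸), e (c • v) = c • e v) (a : 𝔸) : Ring.inverse K a = κ⁻¹ • e.symm a := by
  have hu := isUnit_of_eq_smul_equiv K e hκ hK
  apply ((Module.End.isUnit_iff _).1 hu).1
  rw [← Module.End.mul_apply, Ring.mul_inverse_cancel _ hu, Module.End.one_apply, hK, he, LinearEquiv.apply_symm_apply, smul_smul,
    mul_inv_cancel₀ hκ, one_smul]

/-- the scalar `L^{d+1}` is nonzero. [cite: Balaban1985Averaging, (125) p.36, bookkeeping] -/
private theorem Lpow_ne_zero : ((((ℓ + 1 : ℕ) : ℂ)) ^ (d + 1))⁻¹ ≠ 0 :=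
  inv_ne_zero (pow_ne_zero _ (Nat.cast_ne_zero.2 (Nat.succ_ne_zero ℓ)))

/-- ★★★ **`K_c(V)` IS A UNIT FOR EVERY BACKGROUND** (source convention) — no smallness, no curvature hypothesis: the three faces of `Node00.OpsYSectEElim`
(`Q1Y_elimCY`, `elimCY_eq_self_of_constraints`, `sum_tr_elimCY_mul`) need nothing of (3.35). [cite: Balaban1985BackgroundPropagators, (3.157) p.428; Balaban1985Averaging, (125) p.36] -/
theorem isUnit_KY (U : CfgY 𝔸 x.toKIdx) (c : CBondY x) : IsUnit (KY x 𝔳 U c) :=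
  isUnit_of_eq_smul_equiv _ _ Lpow_ne_zero (KY_eq_smul_hol x 𝔳 U c)

/-- ★★★ **`K_c(V)*` IS A UNIT FOR EVERY BACKGROUND** (source convention). [cite: Balaban1985BackgroundPropagators, (3.157) p.428, (3.9) p.391] -/
theorem isUnit_KTY (U : CfgY 𝔸 x.toKIdx) (c : CBondY x) : IsUnit (KTY x 𝔳 U c) :=
  isUnit_of_eq_smul_equiv _ _ Lpow_ne_zero (KTY_eq_smul_hol_symm x 𝔳 U c)

/-- ★★★ **STAR CORNER, GOOD SOURCE BLOCK: `K_c(V)` IS A UNIT FOR EVERY BACKGROUND.** [cite: Balaban1985BackgroundPropagators, (3.157) p.428; Balaban1984PropagatorsII, Lemma 2.4 p.245] -/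
theorem isUnit_KstY_of_goodY (U : CfgY 𝔸 x.toKIdx) (c : CBondStY x) (hg : GoodY x c.1.1) : IsUnit (KstY x 𝔳 U c) :=
  isUnit_of_eq_smul_equiv _ _ Lpow_ne_zero (KstY_eq_smul_hol_of_goodY x 𝔳 U c hg)

/-- ★★★ **STAR CORNER, GOOD SOURCE BLOCK: `K_c(V)*` IS A UNIT FOR EVERY BACKGROUND.** [cite: Balaban1985BackgroundPropagators, (3.157) p.428, (3.9) p.391] -/
theorem isUnit_KTstY_of_goodY (U : CfgY 𝔸 x.toKIdx) (c : CBondStY x) (hg : GoodY x c.1.1) : IsUnit (KTstY x 𝔳 U c) :=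
  isUnit_of_eq_smul_equiv _ _ Lpow_ne_zero (KTstY_eq_smul_hol_symm_of_goodY x 𝔳 U c hg)

/-- ★★ **THE INVERSE PIVOT COEFFICIENT: `K_c(V)⁻¹ = L^{d+1}·(Ad V([c₋, b₀(c)₋]))⁻¹`** (source convention, every background). [cite: Balaban1985BackgroundPropagators, (3.157) p.428] -/
theorem inverse_KY_apply (U : CfgY 𝔸 x.toKIdx) (c : CBondY x) (a : 𝔸) :
    Ring.inverse (KY x 𝔳 U c) a = (((ℓ + 1 : ℕ) : ℂ)) ^ (d + 1) •
      (hol (RUY x 𝔳 U) ((List.range ℓ).map fun i : ℕ => (⟨ofZ x (labK x c.1.1 + (i : ℤ) • unitVec c.1.2), c.1.2⟩ : UBondY x))).symm a := by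
  rw [inverse_apply_of_eq_smul_equiv _ _ Lpow_ne_zero (KY_eq_smul_hol x 𝔳 U c) (fun κ v => hol_smulC (RUY x 𝔳 U) (RUY_smulC x 𝔳 U) κ _ v), inv_inv]

/-- ★★ **THE INVERSE TRANSPOSED PIVOT COEFFICIENT: `(K_c(V)*)⁻¹ = L^{d+1}·Ad V([c₋, b₀(c)₋])`** (source convention, every background). [cite: Balaban1985BackgroundPropagators, (3.157) p.428, (3.9) p.391] -/
theorem inverse_KTY_apply (U : CfgY 𝔸 x.toKIdx) (c : CBondY x) (v : 𝔸) :
    Ring.inverse (KTY x 𝔳 U c) v = (((ℓ + 1 : ℕ) : ℂ)) ^ (d + 1) •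
      hol (RUY x 𝔳 U) ((List.range ℓ).map fun i : ℕ => (⟨ofZ x (labK x c.1.1 + (i : ℤ) • unitVec c.1.2), c.1.2⟩ : UBondY x)) v := by
  rw [inverse_apply_of_eq_smul_equiv _ _ Lpow_ne_zero (KTY_eq_smul_hol_symm x 𝔳 U c)
    (fun κ w => hol_symm_smulC (RUY x 𝔳 U) (RUY_smulC x 𝔳 U) κ _ w), inv_inv, LinearEquiv.symm_symm]

/-- ★★ star corner, good source block: `K_c(V)⁻¹ = L^{d+1}·(Ad V([c₋, b₀(c)₋]))⁻¹`, every background. [cite: Balaban1985BackgroundPropagators, (3.157) p.428] -/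
theorem inverse_KstY_apply_of_goodY (U : CfgY 𝔸 x.toKIdx) (c : CBondStY x) (hg : GoodY x c.1.1) (a : 𝔸) :
    Ring.inverse (KstY x 𝔳 U c) a = (((ℓ + 1 : ℕ) : ℂ)) ^ (d + 1) •
      (hol (RUY x 𝔳 U) ((List.range ℓ).map fun i : ℕ => (⟨ofZ x (labK x c.1.1 + (i : ℤ) • unitVec c.1.2), c.1.2⟩ : UBondY x))).symm a := by
  rw [inverse_apply_of_eq_smul_equiv _ _ Lpow_ne_zero (KstY_eq_smul_hol_of_goodY x 𝔳 U c hg)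
    (fun κ v => hol_smulC (RUY x 𝔳 U) (RUY_smulC x 𝔳 U) κ _ v), inv_inv]

/-- ★★ star corner, good source block: `(K_c(V)*)⁻¹ = L^{d+1}·Ad V([c₋, b₀(c)₋])`, every background. [cite: Balaban1985BackgroundPropagators, (3.157) p.428, (3.9) p.391] -/
theorem inverse_KTstY_apply_of_goodY (U : CfgY 𝔸 x.toKIdx) (c : CBondStY x) (hg : GoodY x c.1.1) (v : 𝔸) :
    Ring.inverse (KTstY x 𝔳 U c) v = (((ℓ + 1 : ℕ) : ℂ)) ^ (d + 1) •
      hol (RUY x 𝔳 U) ((List.range ℓ).map fun i : ℕ => (⟨ofZ x (labK x c.1.1 + (i : ℤ) • unitVec c.1.2), c.1.2⟩ : UBondY x)) v := by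
  rw [inverse_apply_of_eq_smul_equiv _ _ Lpow_ne_zero (KTstY_eq_smul_hol_symm_of_goodY x 𝔳 U c hg)
    (fun κ w => hol_symm_smulC (RUY x 𝔳 U) (RUY_smulC x 𝔳 U) κ _ w), inv_inv, LinearEquiv.symm_symm]

/-! ### norms for contraction-valued fields (`‖V(b)‖ ≤ 1`, `‖V(b)⁻¹‖ ≤ 1`, e.g. `U(N)`-valued) -/

variable {G : Subgroup 𝔸ˣ}

/-- contraction-valued transports contract. [cite: Balaban1985BackgroundPropagators, (3.3) p.390, bookkeeping] -/
theorem norm_RUY_le (hG1 : ∀ g ∈ G, ‖((g : 𝔸ˣ) : 𝔸)‖ ≤ 1) {U : CfgY 𝔸 x.toKIdx} (h𝔳 : ∀ b, 𝔳 U b ∈ G) (b : UBondY x) (v : 𝔸) :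
    ‖RUY x 𝔳 U b v‖ ≤ ‖v‖ := by
  rw [RUY_apply]; exact B9Eq310Hermitian.norm_R_le (hG1 _ (h𝔳 b)) (hG1 _ (G.inv_mem (h𝔳 b))) v

/-- inverse contraction-valued transports contract. [cite: Balaban1985BackgroundPropagators, (3.3) p.390, (3.9) p.391, bookkeeping] -/
theorem norm_RUY_symm_le (hG1 : ∀ g ∈ G, ‖((g : 𝔸ˣ) : 𝔸)‖ ≤ 1) {U : CfgY 𝔸 x.toKIdx} (h𝔳 : ∀ b, 𝔳 U b ∈ G) (b : UBondY x) (v : 𝔸) :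
    ‖(RUY x 𝔳 U b).symm v‖ ≤ ‖v‖ := by
  rw [RUY_symm_apply]
  refine B9Eq310Hermitian.norm_R_le (hG1 _ (G.inv_mem (h𝔳 b))) ?_ v
  rw [inv_inv]; exact hG1 _ (h𝔳 b)

/-- ★ **`‖K_c(V) a‖ ≤ L^{−(d+1)}‖a‖`** for contraction-valued `V` (source convention, every such background). [cite: Balaban1985Averaging, (126) p.36; Balaban1985BackgroundPropagators, p.428] -/
theorem norm_KY_apply_le (hG1 : ∀ g ∈ G, ‖((g : 𝔸ˣ) : 𝔸)‖ ≤ 1) {U : CfgY 𝔸 x.toKIdx} (h𝔳 : ∀ b, 𝔳 U b ∈ G) (c : CBondY x) (a : 𝔸) :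
    ‖KY x 𝔳 U c a‖ ≤ ((((ℓ + 1 : ℕ) : ℝ)) ^ (d + 1))⁻¹ * ‖a‖ := by
  rw [KY_eq_smul_hol, norm_smul, norm_inv, norm_pow, Complex.norm_natCast]
  exact mul_le_mul_of_nonneg_left (norm_hol_le _ (norm_RUY_le x 𝔳 hG1 h𝔳) _ _) (by positivity)

/-- ★★ **`‖K_c(V)⁻¹ a‖ ≤ L^{d+1}‖a‖` — THE SHARP PIVOT-INVERSE ROW** for contraction-valued `V` (source convention, every such background; the `κ_K` of
`…ERowsAtNode00StarSmall` is `1`). [cite: Balaban1985BackgroundPropagators, (3.157) p.428; Balaban1985Averaging, (126) p.36] -/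
theorem norm_inverse_KY_apply_le (hG1 : ∀ g ∈ G, ‖((g : 𝔸ˣ) : 𝔸)‖ ≤ 1) {U : CfgY 𝔸 x.toKIdx} (h𝔳 : ∀ b, 𝔳 U b ∈ G) (c : CBondY x) (a : 𝔸) :
    ‖Ring.inverse (KY x 𝔳 U c) a‖ ≤ (((ℓ + 1 : ℕ) : ℝ)) ^ (d + 1) * ‖a‖ := by
  rw [inverse_KY_apply, norm_smul, norm_pow, Complex.norm_natCast]
  exact mul_le_mul_of_nonneg_left (norm_hol_symm_le _ (norm_RUY_symm_le x 𝔳 hG1 h𝔳) _ _) (by positivity)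

/-- ★★ **`‖(K_c(V)*)⁻¹ v‖ ≤ L^{d+1}‖v‖`** for contraction-valued `V` (source convention, every such background). [cite: Balaban1985BackgroundPropagators, (3.157) p.428, (3.9) p.391] -/
theorem norm_inverse_KTY_apply_le (hG1 : ∀ g ∈ G, ‖((g : 𝔸ˣ) : 𝔸)‖ ≤ 1) {U : CfgY 𝔸 x.toKIdx} (h𝔳 : ∀ b, 𝔳 U b ∈ G) (c : CBondY x) (v : 𝔸) :
    ‖Ring.inverse (KTY x 𝔳 U c) v‖ ≤ (((ℓ + 1 : ℕ) : ℝ)) ^ (d + 1) * ‖v‖ := by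
  rw [inverse_KTY_apply, norm_smul, norm_pow, Complex.norm_natCast]
  exact mul_le_mul_of_nonneg_left (norm_hol_le _ (norm_RUY_le x 𝔳 hG1 h𝔳) _ _) (by positivity)

/-- ★★ star corner, good source block: `‖K_c(V)⁻¹ a‖ ≤ L^{d+1}‖a‖` for contraction-valued `V`, every such background. [cite: Balaban1985BackgroundPropagators, (3.157) p.428] -/
theorem norm_inverse_KstY_apply_le_of_goodY (hG1 : ∀ g ∈ G, ‖((g : 𝔸ˣ) : 𝔸)‖ ≤ 1) {U : CfgY 𝔸 x.toKIdx} (h𝔳 : ∀ b, 𝔳 U b ∈ G) (c : CBondStY x)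
    (hg : GoodY x c.1.1) (a : 𝔸) : ‖Ring.inverse (KstY x 𝔳 U c) a‖ ≤ (((ℓ + 1 : ℕ) : ℝ)) ^ (d + 1) * ‖a‖ := by
  rw [inverse_KstY_apply_of_goodY x 𝔳 U c hg, norm_smul, norm_pow, Complex.norm_natCast]
  exact mul_le_mul_of_nonneg_left (norm_hol_symm_le _ (norm_RUY_symm_le x 𝔳 hG1 h𝔳) _ _) (by positivity)

/-- ★★ star corner, good source block: `‖(K_c(V)*)⁻¹ v‖ ≤ L^{d+1}‖v‖` for contraction-valued `V`, every such background. [cite: Balaban1985BackgroundPropagators, (3.157) p.428, (3.9) p.391] -/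
theorem norm_inverse_KTstY_apply_le_of_goodY (hG1 : ∀ g ∈ G, ‖((g : 𝔸ˣ) : 𝔸)‖ ≤ 1) {U : CfgY 𝔸 x.toKIdx} (h𝔳 : ∀ b, 𝔳 U b ∈ G) (c : CBondStY x)
    (hg : GoodY x c.1.1) (v : 𝔸) : ‖Ring.inverse (KTstY x 𝔳 U c) v‖ ≤ (((ℓ + 1 : ℕ) : ℝ)) ^ (d + 1) * ‖v‖ := by
  rw [inverse_KTstY_apply_of_goodY x 𝔳 U c hg, norm_smul, norm_pow, Complex.norm_natCast]
  exact mul_le_mul_of_nonneg_left (norm_hol_le _ (norm_RUY_le x 𝔳 hG1 h𝔳) _ _) (by positivity)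

/-! ### the three faces of (3.157), source convention, at EVERY background -/

/-- ★★★ **THE CONSTRAINTS HOLD ON THE RANGE OF `C(V)` AT EVERY BACKGROUND**: `(Q(V)(C(V)B))(c) = 0`, `c ∈ Λ′` — `OpsYSectEElim.Q1Y_elimCY` with its unit
hypothesis discharged by `isUnit_KY`. [cite: Balaban1985BackgroundPropagators, (3.157) p.428; Balaban1984PropagatorsII, (2.154)–(2.156) pp.249–250] -/
theorem Q1Y_elimCY_all (U : CfgY 𝔸 x.toKIdx) (c : CBondY x) (B : IBondY x.toKIdx → 𝔸) : Q1Y x 𝔳 U c.1 (elimCY x 𝔳 U B) = 0 :=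
  Q1Y_elimCY x 𝔳 U (isUnit_KY x 𝔳 U c) B

/-- ★★★ **`B = C(V)B̃` IS A PARAMETRISATION AT EVERY BACKGROUND** — `OpsYSectEElim.elimCY_eq_self_of_constraints`, unit hypothesis discharged.
[cite: Balaban1985BackgroundPropagators, (3.157) p.428 («an arbitrary function B on this subspace can be represented»)] -/
theorem elimCY_eq_self_of_constraints_all (U : CfgY 𝔸 x.toKIdx) (B : IBondY x.toKIdx → 𝔸) (hsupp : ∀ q, ¬ lamTY x q → ¬ IsPivY x q → B q = 0)
    (hQ : ∀ c : CBondY x, Q1Y x 𝔳 U c.1 B = 0) : elimCY x 𝔳 U B = B :=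
  elimCY_eq_self_of_constraints x 𝔳 U B (isUnit_KY x 𝔳 U) hsupp hQ

/-- ★★★ **`C(V)*` IS THE TRACE-TRANSPOSE OF `C(V)` AT EVERY BACKGROUND** — `OpsYSectEElim.sum_tr_elimCY_mul`, both unit hypotheses discharged.
[cite: Balaban1985BackgroundPropagators, (3.157) p.428 («C*»), (3.9) p.391] -/
theorem sum_tr_elimCY_mul_all (τ : 𝔸 →ₗ[ℂ] ℂ) (hτ : ∀ a b : 𝔸, τ (a * b) = τ (b * a)) (U : CfgY 𝔸 x.toKIdx) (B A : IBondY x.toKIdx → 𝔸) :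
    ∑ q, τ (elimCY x 𝔳 U B q * A q) = ∑ q, τ (B q * elimCtY x 𝔳 U A q) :=
  sum_tr_elimCY_mul x 𝔳 τ hτ U (isUnit_KY x 𝔳 U) (isUnit_KTY x 𝔳 U) B A

end GoodSource

/-! ## §3 The located dictionary point: star corners with a BAD source block (`uΓ = []` there) — averaged partial holonomies; small field on the pivot line -/

section BadSource

variable {𝔸 : Type} [NormedRing 𝔸] [NormedAlgebra ℂ 𝔸] [CompleteSpace 𝔸]
variable (x : MemberY d ℓ hd hL b₀ b₁ Mstar) (𝔳 : AvY 𝔸 x)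

/-- ★★ **BAD SOURCE BLOCK (only `c₊` good): `K_c(V) a = L^{−(d+2)} Σ_{s<L} Ad V([c₋ + (L−1−s)e_μ, b₀(c)₋]) a`** — dictionary deviation of NODE 00: transport comb
empty off `Λ′` (`OpsYSectELetters.uΓ_of_not_good`; print's (14) ∕ (125) carry the comb `Γ_{c₋,x}` of every block at which `Q` is read), so the `L` readings of the
pivot carry the PARTIAL line transports from the axis points, an average of `L` different conjugations (print's comb on `B(c₋)` would make them all equal, as
in §2; node00-def-Y RULING-25 (ii)). [cite: Balaban1985Averaging, (125) p.36, (14) p.19; Balaban1985BackgroundPropagators, (3.169) p.430 + p.428] -/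
theorem KstY_eq_sum_of_not_goodY (U : CfgY 𝔸 x.toKIdx) (c : CBondStY x) (hg : ¬ GoodY x c.1.1) (a : 𝔸) :
    KstY x 𝔳 U c a = qNormY d ℓ • ∑ s ∈ Finset.range (ℓ + 1),
      hol (RUY x 𝔳 U) ((List.range s).map fun i : ℕ => (⟨ofZ x (labK x c.1.1 + ((ℓ - s + i : ℕ) : ℤ) • unitVec c.1.2), c.1.2⟩ : UBondY x)) a := by
  obtain ⟨⟨y, μ⟩, hc⟩ := c
  have hy : IsCornerY x y := ((mem_coarseStY x).1 hc).1
  rw [KstY_apply]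
  unfold pivIStY
  rw [Q1Y_single_upivU_eq_sum x 𝔳 hy μ _ U a]
  congr 1
  refine Finset.sum_congr rfl fun s hs => ?_
  rw [Finset.mem_range] at hs
  have hz : ¬ GoodY x (ofZ x (labK x y + ((ℓ : ℤ) - s) • unitVec μ)) := fun h =>
    hg ((goodY_iff_of_blockOf_eq x (blockOf_eq_of_mem_ublockY x (ofZ_add_mem_ublockY x hy μ (by omega) (by omega)))).1 h)
  rw [uΓ_of_not_good x hz, hol_nil, LinearEquiv.refl_apply, show ((ℓ : ℤ) - s) = ((ℓ - s : ℕ) : ℤ) by omega,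
    labK_ofZ_axis x hy μ (by positivity) (by omega)]
  congr 2
  apply List.map_congr_left
  intro i _
  simp only [Nat.cast_add, add_smul, add_assoc]

/-- ★★ **BAD SOURCE BLOCK, TRANSPOSED: `K_c(V)* v = L^{−(d+2)} Σ_{s<L} (Ad V([c₋ + (L−1−s)e_μ, b₀(c)₋]))⁻¹ v`** (same dictionary deviation: transport comb
empty off `Λ′`, `uΓ_of_not_good`). [cite: Balaban1985Averaging, (125) p.36, (14) p.19; Balaban1985BackgroundPropagators, (3.169) p.430 + p.428, (3.9) p.391] -/
theorem KTstY_eq_sum_of_not_goodY (U : CfgY 𝔸 x.toKIdx) (c : CBondStY x) (hg : ¬ GoodY x c.1.1) (v : 𝔸) :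
    KTstY x 𝔳 U c v = qNormY d ℓ • ∑ s ∈ Finset.range (ℓ + 1),
      (hol (RUY x 𝔳 U) ((List.range s).map fun i : ℕ => (⟨ofZ x (labK x c.1.1 + ((ℓ - s + i : ℕ) : ℤ) • unitVec c.1.2), c.1.2⟩ : UBondY x))).symm v := by
  obtain ⟨⟨y, μ⟩, hc⟩ := c
  have hy : IsCornerY x y := ((mem_coarseStY x).1 hc).1
  rw [KTstY_apply]
  unfold pivIStY
  rw [Q1TY_apply_upivU_eq_sum x 𝔳 hy μ _ U v]
  congr 1
  refine Finset.sum_congr rfl fun s hs => ?_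
  rw [Finset.mem_range] at hs
  have hz : ¬ GoodY x (ofZ x (labK x y + ((ℓ : ℤ) - s) • unitVec μ)) := fun h =>
    hg ((goodY_iff_of_blockOf_eq x (blockOf_eq_of_mem_ublockY x (ofZ_add_mem_ublockY x hy μ (by omega) (by omega)))).1 h)
  rw [uΓ_of_not_good x hz, hol_nil, LinearEquiv.refl_symm, LinearEquiv.refl_apply, show ((ℓ : ℤ) - s) = ((ℓ - s : ℕ) : ℤ) by omega,
    labK_ofZ_axis x hy μ (by positivity) (by omega)]
  congr 3
  apply List.map_congr_left
  intro i _
  simp only [Nat.cast_add, add_smul, add_assoc]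

variable {G : Subgroup 𝔸ˣ}

omit [NormedAlgebra ℂ 𝔸] [CompleteSpace 𝔸] in
/-- `‖V⁻¹ − 1‖ ≤ δ` from `‖V − 1‖ ≤ δ` for a contraction `V⁻¹` (`V⁻¹ − 1 = V⁻¹(1 − V)`). [cite: Balaban1985BackgroundPropagators, (3.35) p.397, bookkeeping] -/
theorem norm_inv_sub_one_le {V : 𝔸ˣ} (h2 : ‖((V⁻¹ : 𝔸ˣ) : 𝔸)‖ ≤ 1) {δ : ℝ} (hδ : ‖(V : 𝔸) - 1‖ ≤ δ) : ‖((V⁻¹ : 𝔸ˣ) : 𝔸) - 1‖ ≤ δ := by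
  have e : ((V⁻¹ : 𝔸ˣ) : 𝔸) - 1 = ((V⁻¹ : 𝔸ˣ) : 𝔸) * (1 - (V : 𝔸)) := by rw [mul_sub, mul_one, Units.inv_mul]
  rw [e]
  refine (norm_mul_le _ _).trans ?_
  rw [norm_sub_rev]
  calc ‖((V⁻¹ : 𝔸ˣ) : 𝔸)‖ * ‖(V : 𝔸) - 1‖ ≤ 1 * δ := mul_le_mul h2 hδ (norm_nonneg _) zero_le_one
    _ = δ := one_mul δ

omit [CompleteSpace 𝔸] in
/-- the inverse transport along a contour whose bond transports contract and move values by at most `δ` each moves a value by at most `|Γ|·δ` (hypotheses on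
the bonds OF THE CONTOUR only). [cite: Balaban1985BackgroundPropagators, (3.35) p.397, (3.169) p.430, (3.9) p.391, bookkeeping] -/
theorem norm_hol_symm_sub_self_le_of_forall_mem {Bond : Type} (T : Bond → 𝔸 ≃ₗ[ℝ] 𝔸) (hT' : ∀ b v, ‖(T b).symm v‖ ≤ ‖v‖) {δ : ℝ} (hδ0 : 0 ≤ δ) :
    ∀ (Γ : List Bond), (∀ b ∈ Γ, ∀ v, ‖(T b).symm v - v‖ ≤ δ * ‖v‖) → ∀ v : 𝔸, ‖(hol T Γ).symm v - v‖ ≤ Γ.length * δ * ‖v‖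
  | [], _, v => by simp
  | b :: Γ, hδ, v => by
      have e0 : (hol T (b :: Γ)).symm v = (hol T Γ).symm ((T b).symm v) := by
        show ((hol T Γ).trans (T b)).symm v = _
        rw [LinearEquiv.symm_trans_apply]
      rw [e0, List.length_cons]
      have e : (hol T Γ).symm ((T b).symm v) - v = ((hol T Γ).symm ((T b).symm v) - (T b).symm v) + ((T b).symm v - v) := by abel
      rw [e]
      refine (norm_add_le _ _).trans ?_
      have h1 := norm_hol_symm_sub_self_le_of_forall_mem T hT' hδ0 Γ (fun b' hb' => hδ b' (List.mem_cons_of_mem b hb')) ((T b).symm v)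
      have h1' : (Γ.length : ℝ) * δ * ‖(T b).symm v‖ ≤ Γ.length * δ * ‖v‖ := mul_le_mul_of_nonneg_left (hT' b v) (by positivity)
      have h2 := hδ b (by simp) v
      push_cast
      linarith

/-- ★★ **BAD SOURCE BLOCK: `K_c(V)` IS A UNIT WHEN `V` IS SMALL ON THE PIVOT LINE** — `‖V(b) − 1‖ ≤ δ` on the `L − 1` unit bonds `[c₋, b₀(c)₋] ⊂ B(c₋)` and
`(L−1)·2δ < 1` suffice (contraction-valued `V`): `‖L^{d+1}K_c(V)a − a‖ ≤ L⁻¹ Σ_{s<L} ‖Ad V(partial line_s) a − a‖ ≤ (L−1)·2δ·‖a‖`, Neumann series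
(`OpsYSectEElimSmall.isUnit_of_norm_smul_sub_le`).  Sharpens `OpsYSectEElimStarSmall.isUnit_KstY_of_smallVY` (smallness on ALL unit bonds,
`L^{d+1}·2δ(L + (d+1)ℓ) < 1`); at a good source block no hypothesis is needed (`isUnit_KstY_of_goodY`).
[cite: Balaban1985BackgroundPropagators, (3.157) p.428, (3.35) p.397; Balaban1985Averaging, (126) p.36] -/
theorem isUnit_KstY_of_small_on_line (hG1 : ∀ g ∈ G, ‖((g : 𝔸ˣ) : 𝔸)‖ ≤ 1) {U : CfgY 𝔸 x.toKIdx} (h𝔳 : ∀ b, 𝔳 U b ∈ G) (c : CBondStY x) {δ : ℝ}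
    (hδ0 : 0 ≤ δ) (hδ : ∀ i : ℕ, i < ℓ → ‖((𝔳 U ⟨ofZ x (labK x c.1.1 + (i : ℤ) • unitVec c.1.2), c.1.2⟩ : 𝔸ˣ) : 𝔸) - 1‖ ≤ δ)
    (hsmall : (ℓ : ℝ) * (2 * δ) < 1) : IsUnit (KstY x 𝔳 U c) := by
  by_cases hg : GoodY x c.1.1
  · exact isUnit_KstY_of_goodY x 𝔳 U c hg
  have hLne : (((ℓ + 1 : ℕ) : ℂ)) ^ (d + 1) ≠ 0 := pow_ne_zero _ (Nat.cast_ne_zero.2 (Nat.succ_ne_zero ℓ))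
  have hL1 : (((ℓ + 1 : ℕ) : ℂ)) ≠ 0 := Nat.cast_ne_zero.2 (Nat.succ_ne_zero ℓ)
  refine isUnit_of_norm_smul_sub_le (KstY x 𝔳 U c) hLne (κ := (ℓ : ℝ) * (2 * δ)) (by positivity) hsmall fun a => ?_
  rw [LinearMap.smul_apply, KstY_eq_sum_of_not_goodY x 𝔳 U c hg a, smul_smul]
  have hq : (((ℓ + 1 : ℕ) : ℂ)) ^ (d + 1) * qNormY d ℓ = ((((ℓ + 1 : ℕ) : ℂ)))⁻¹ := by
    rw [qNormY, show (((ℓ + 1 : ℕ) : ℂ)) ^ (d + 2) = (((ℓ + 1 : ℕ) : ℂ)) ^ (d + 1) * (((ℓ + 1 : ℕ) : ℂ)) from pow_succ _ _, mul_inv, ← mul_assoc,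
      mul_inv_cancel₀ hLne, one_mul]
  rw [hq]
  set F : ℕ → 𝔸 := fun s => hol (RUY x 𝔳 U) ((List.range s).map fun i : ℕ =>
    (⟨ofZ x (labK x c.1.1 + ((ℓ - s + i : ℕ) : ℤ) • unitVec c.1.2), c.1.2⟩ : UBondY x)) a with hF
  have e : ((((ℓ + 1 : ℕ) : ℂ)))⁻¹ • (∑ s ∈ Finset.range (ℓ + 1), F s) - a = ((((ℓ + 1 : ℕ) : ℂ)))⁻¹ • ∑ s ∈ Finset.range (ℓ + 1), (F s - a) := by
    rw [Finset.sum_sub_distrib, smul_sub, Finset.sum_const, Finset.card_range, ← Nat.cast_smul_eq_nsmul ℂ, smul_smul, inv_mul_cancel₀ hL1, one_smul]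
  rw [e, norm_smul, norm_inv, Complex.norm_natCast]
  have hterm : ∀ s ∈ Finset.range (ℓ + 1), ‖F s - a‖ ≤ (ℓ : ℝ) * (2 * δ) * ‖a‖ := by
    intro s hs
    rw [Finset.mem_range] at hs
    have h1 := norm_hol_sub_self_le_of_forall_mem (RUY x 𝔳 U) (norm_RUY_le x 𝔳 hG1 h𝔳) (δ := 2 * δ)
      ((List.range s).map fun i : ℕ => (⟨ofZ x (labK x c.1.1 + ((ℓ - s + i : ℕ) : ℤ) • unitVec c.1.2), c.1.2⟩ : UBondY x)) ?_ a
    · rw [List.length_map, List.length_range] at h1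
      refine h1.trans ?_
      have hsℓ : (s : ℝ) ≤ ℓ := by exact_mod_cast (by omega : s ≤ ℓ)
      have := norm_nonneg a
      gcongr
    · intro b hb v
      rw [List.mem_map] at hb
      obtain ⟨i, hi, rfl⟩ := hb
      rw [List.mem_range] at hi
      rw [RUY_apply]
      exact norm_R_sub_self_le_of_le (hG1 _ (G.inv_mem (h𝔳 _))) (hδ (ℓ - s + i) (by omega)) v
  refine (mul_le_mul_of_nonneg_left ((norm_sum_le _ _).trans (Finset.sum_le_card_nsmul _ _ _ hterm)) (by positivity)).trans ?_
  rw [Finset.card_range, nsmul_eq_mul, ← mul_assoc, inv_mul_cancel₀ (Nat.cast_ne_zero.2 (Nat.succ_ne_zero ℓ)), one_mul]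

/-- ★★ **BAD SOURCE BLOCK: `K_c(V)*` IS A UNIT WHEN `V` IS SMALL ON THE PIVOT LINE** (same hypotheses; transposed readings through `Ad V(b)⁻¹`).
[cite: Balaban1985BackgroundPropagators, (3.157) p.428, (3.9) p.391, (3.35) p.397; Balaban1985Averaging, (126) p.36] -/
theorem isUnit_KTstY_of_small_on_line (hG1 : ∀ g ∈ G, ‖((g : 𝔸ˣ) : 𝔸)‖ ≤ 1) {U : CfgY 𝔸 x.toKIdx} (h𝔳 : ∀ b, 𝔳 U b ∈ G) (c : CBondStY x) {δ : ℝ}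
    (hδ0 : 0 ≤ δ) (hδ : ∀ i : ℕ, i < ℓ → ‖((𝔳 U ⟨ofZ x (labK x c.1.1 + (i : ℤ) • unitVec c.1.2), c.1.2⟩ : 𝔸ˣ) : 𝔸) - 1‖ ≤ δ)
    (hsmall : (ℓ : ℝ) * (2 * δ) < 1) : IsUnit (KTstY x 𝔳 U c) := by
  by_cases hg : GoodY x c.1.1
  · exact isUnit_KTstY_of_goodY x 𝔳 U c hg
  have hLne : (((ℓ + 1 : ℕ) : ℂ)) ^ (d + 1) ≠ 0 := pow_ne_zero _ (Nat.cast_ne_zero.2 (Nat.succ_ne_zero ℓ))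
  have hL1 : (((ℓ + 1 : ℕ) : ℂ)) ≠ 0 := Nat.cast_ne_zero.2 (Nat.succ_ne_zero ℓ)
  refine isUnit_of_norm_smul_sub_le (KTstY x 𝔳 U c) hLne (κ := (ℓ : ℝ) * (2 * δ)) (by positivity) hsmall fun v => ?_
  rw [LinearMap.smul_apply, KTstY_eq_sum_of_not_goodY x 𝔳 U c hg v, smul_smul]
  have hq : (((ℓ + 1 : ℕ) : ℂ)) ^ (d + 1) * qNormY d ℓ = ((((ℓ + 1 : ℕ) : ℂ)))⁻¹ := by
    rw [qNormY, show (((ℓ + 1 : ℕ) : ℂ)) ^ (d + 2) = (((ℓ + 1 : ℕ) : ℂ)) ^ (d + 1) * (((ℓ + 1 : ℕ) : ℂ)) from pow_succ _ _, mul_inv, ← mul_assoc,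
      mul_inv_cancel₀ hLne, one_mul]
  rw [hq]
  set F : ℕ → 𝔸 := fun s => (hol (RUY x 𝔳 U) ((List.range s).map fun i : ℕ =>
    (⟨ofZ x (labK x c.1.1 + ((ℓ - s + i : ℕ) : ℤ) • unitVec c.1.2), c.1.2⟩ : UBondY x))).symm v with hF
  have e : ((((ℓ + 1 : ℕ) : ℂ)))⁻¹ • (∑ s ∈ Finset.range (ℓ + 1), F s) - v = ((((ℓ + 1 : ℕ) : ℂ)))⁻¹ • ∑ s ∈ Finset.range (ℓ + 1), (F s - v) := by
    rw [Finset.sum_sub_distrib, smul_sub, Finset.sum_const, Finset.card_range, ← Nat.cast_smul_eq_nsmul ℂ, smul_smul, inv_mul_cancel₀ hL1, one_smul]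
  rw [e, norm_smul, norm_inv, Complex.norm_natCast]
  have hterm : ∀ s ∈ Finset.range (ℓ + 1), ‖F s - v‖ ≤ (ℓ : ℝ) * (2 * δ) * ‖v‖ := by
    intro s hs
    rw [Finset.mem_range] at hs
    have h1 := norm_hol_symm_sub_self_le_of_forall_mem (RUY x 𝔳 U) (norm_RUY_symm_le x 𝔳 hG1 h𝔳) (δ := 2 * δ) (by positivity)
      ((List.range s).map fun i : ℕ => (⟨ofZ x (labK x c.1.1 + ((ℓ - s + i : ℕ) : ℤ) • unitVec c.1.2), c.1.2⟩ : UBondY x)) ?_ v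
    · rw [List.length_map, List.length_range] at h1
      refine h1.trans ?_
      have hsℓ : (s : ℝ) ≤ ℓ := by exact_mod_cast (by omega : s ≤ ℓ)
      have := norm_nonneg v
      gcongr
    · intro b hb w
      rw [List.mem_map] at hb
      obtain ⟨i, hi, rfl⟩ := hb
      rw [List.mem_range] at hi
      rw [RUY_symm_apply]
      refine norm_R_sub_self_le_of_le ?_ (norm_inv_sub_one_le (hG1 _ (G.inv_mem (h𝔳 _))) (hδ (ℓ - s + i) (by omega))) w
      rw [inv_inv]; exact hG1 _ (h𝔳 _)
  refine (mul_le_mul_of_nonneg_left ((norm_sum_le _ _).trans (Finset.sum_le_card_nsmul _ _ _ hterm)) (by positivity)).trans ?_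
  rw [Finset.card_range, nsmul_eq_mul, ← mul_assoc, inv_mul_cancel₀ (Nat.cast_ne_zero.2 (Nat.succ_ne_zero ℓ)), one_mul]

end BadSource

/-! ## §4 At the record (`𝔸 = M_N(ℂ)` with the C⋆-norm, `V = avYOfRecord x U`): the v6 Sect. E letters' faces at EVERY background; the pivot-inverse row for `G ≤ U(N)` -/

section Record

open scoped Matrix.Norms.L2Operator
open B7Prop2Explicit (unitaryUnits)

variable (N : ℕ) (θ : Stage3Params) (Mstar : ℕ) (𝔢₀ : SectEY N θ Mstar)

/-- ★★★ **THE v6 RECORD'S `C ∕ C*` ARE TRACE-TRANSPOSES OF EACH OTHER AT EVERY BACKGROUND — NO REGIME** (`OpsYSectEElim.sum_trace_elimC_elimCt_sectEYOfRecordV6`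
with both `IsUnit` rows discharged by §2; supersedes `…_of_smallVY` of `OpsYSectEElimSmall` for this face). [cite: Balaban1985BackgroundPropagators, (3.157) p.428 («C*»), (3.9) p.391] -/
theorem sum_trace_elimC_elimCt_sectEYOfRecordV6_all (x : MemberY θ.d₆ θ.ℓ₆ θ.hd' θ.hL' θ.b₀ θ.b₁ Mstar) (U : CfgY (Matrix (Fin N) (Fin N) ℂ) x.toKIdx)
    (B A : IBondY x.toKIdx → Matrix (Fin N) (Fin N) ℂ) :
    ∑ q, Matrix.trace ((sectEYOfRecordV6 N θ Mstar 𝔢₀ x).elimC U B q * A q) =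
      ∑ q, Matrix.trace (B q * (sectEYOfRecordV6 N θ Mstar 𝔢₀ x).elimCt U A q) :=
  sum_trace_elimC_elimCt_sectEYOfRecordV6 N θ Mstar 𝔢₀ x U (isUnit_KY x _ U) (isUnit_KTY x _ U) B A

/-- ★★★ **THE v6 RECORD'S `C` MAPS INTO THE CONSTRAINED SUBSPACE AT EVERY BACKGROUND**: `(Q(V)(C B))(c) = 0` at every coarse bond, no regime.
[cite: Balaban1985BackgroundPropagators, (3.157) p.428; Balaban1985Averaging, (125) p.36] -/
theorem Q1Y_elimC_sectEYOfRecordV6_all (x : MemberY θ.d₆ θ.ℓ₆ θ.hd' θ.hL' θ.b₀ θ.b₁ Mstar) (U : CfgY (Matrix (Fin N) (Fin N) ℂ) x.toKIdx) (c : CBondY x)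
    (B : IBondY x.toKIdx → Matrix (Fin N) (Fin N) ℂ) :
    Q1Y x (avYOfRecord x) U c.1 ((sectEYOfRecordV6 N θ Mstar 𝔢₀ x).elimC U B) = 0 :=
  Q1Y_elimCY_all x _ U c B

/-- ★★★ **THE v6 RECORD'S `C` PARAMETRISES THE CONSTRAINED SUBSPACE AT EVERY BACKGROUND** (print's «B = CB̃»), no regime.
[cite: Balaban1985BackgroundPropagators, (3.157) p.428; Balaban1984PropagatorsII, (2.154)–(2.156) pp.249–250] -/
theorem elimC_sectEYOfRecordV6_eq_self_of_constraints_all (x : MemberY θ.d₆ θ.ℓ₆ θ.hd' θ.hL' θ.b₀ θ.b₁ Mstar) (U : CfgY (Matrix (Fin N) (Fin N) ℂ) x.toKIdx)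
    (B : IBondY x.toKIdx → Matrix (Fin N) (Fin N) ℂ) (hsupp : ∀ q, ¬ lamTY x q → ¬ IsPivY x q → B q = 0)
    (hQ : ∀ c : CBondY x, Q1Y x (avYOfRecord x) U c.1 B = 0) : (sectEYOfRecordV6 N θ Mstar 𝔢₀ x).elimC U B = B :=
  elimCY_eq_self_of_constraints_all x _ U B hsupp hQ

/-- ★★ **THE PIVOT-INVERSE ROW OF RECORD FOR `G ≤ U(N)`, EVERY `G`-VALUED BACKGROUND**: `‖K_c(V)⁻¹ a‖ ≤ L^{d+1}‖a‖` for the averaged field of record (`hG1` by the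
C⋆-identity `norm_coe_le_one_of_le_unitaryUnits`, `G`-valuedness by `avYOfRecord_mem`). [cite: Balaban1985BackgroundPropagators, (3.157) p.428, (3.40) p.397] -/
theorem norm_inverse_KY_avYOfRecord_apply_le (x : MemberY θ.d₆ θ.ℓ₆ θ.hd' θ.hL' θ.b₀ θ.b₁ Mstar) {G : Subgroup (Matrix (Fin N) (Fin N) ℂ)ˣ}
    (hG : G ≤ unitaryUnits (Matrix (Fin N) (Fin N) ℂ)) {U : CfgY (Matrix (Fin N) (Fin N) ℂ) x.toKIdx} (hU : ∀ μ z, U μ z ∈ G) (c : CBondY x)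
    (a : Matrix (Fin N) (Fin N) ℂ) :
    ‖Ring.inverse (KY x (avYOfRecord x) U c) a‖ ≤ (((θ.ℓ₆ + 1 : ℕ) : ℝ)) ^ (θ.d₆ + 1) * ‖a‖ :=
  norm_inverse_KY_apply_le x _ (norm_coe_le_one_of_le_unitaryUnits hG) (fun b => avYOfRecord_mem x hU b) c a

/-- ★★ the transposed pivot-inverse row of record for `G ≤ U(N)`, every `G`-valued background. [cite: Balaban1985BackgroundPropagators, (3.157) p.428, (3.9) p.391] -/
theorem norm_inverse_KTY_avYOfRecord_apply_le (x : MemberY θ.d₆ θ.ℓ₆ θ.hd' θ.hL' θ.b₀ θ.b₁ Mstar) {G : Subgroup (Matrix (Fin N) (Fin N) ℂ)ˣ}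
    (hG : G ≤ unitaryUnits (Matrix (Fin N) (Fin N) ℂ)) {U : CfgY (Matrix (Fin N) (Fin N) ℂ) x.toKIdx} (hU : ∀ μ z, U μ z ∈ G) (c : CBondY x)
    (v : Matrix (Fin N) (Fin N) ℂ) :
    ‖Ring.inverse (KTY x (avYOfRecord x) U c) v‖ ≤ (((θ.ℓ₆ + 1 : ℕ) : ℝ)) ^ (θ.d₆ + 1) * ‖v‖ :=
  norm_inverse_KTY_apply_le x _ (norm_coe_le_one_of_le_unitaryUnits hG) (fun b => avYOfRecord_mem x hU b) c v

/-- ★★ star corner with a good source block, at the record: `K_c(V)` and `K_c(V)*` are units and `‖K_c(V)⁻¹ a‖ ≤ L^{d+1}‖a‖` for `G ≤ U(N)`, every `G`-valued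
background — the `hK ∕ hKT ∕ hKinv` rows of the star door of record at those corners. [cite: Balaban1985BackgroundPropagators, (3.157) p.428; Balaban1984PropagatorsII, Lemma 2.4 p.245] -/
theorem star_pivot_rows_avYOfRecord_of_goodY (x : MemberY θ.d₆ θ.ℓ₆ θ.hd' θ.hL' θ.b₀ θ.b₁ Mstar) {G : Subgroup (Matrix (Fin N) (Fin N) ℂ)ˣ}
    (hG : G ≤ unitaryUnits (Matrix (Fin N) (Fin N) ℂ)) {U : CfgY (Matrix (Fin N) (Fin N) ℂ) x.toKIdx} (hU : ∀ μ z, U μ z ∈ G) (c : CBondStY x)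
    (hg : GoodY x c.1.1) :
    IsUnit (KstY x (avYOfRecord x) U c) ∧ IsUnit (KTstY x (avYOfRecord x) U c) ∧
      ∀ a : Matrix (Fin N) (Fin N) ℂ, ‖Ring.inverse (KstY x (avYOfRecord x) U c) a‖ ≤ (((θ.ℓ₆ + 1 : ℕ) : ℝ)) ^ (θ.d₆ + 1) * ‖a‖ :=
  ⟨isUnit_KstY_of_goodY x _ U c hg, isUnit_KTstY_of_goodY x _ U c hg, fun a =>
    norm_inverse_KstY_apply_le_of_goodY x _ (norm_coe_le_one_of_le_unitaryUnits hG) (fun b => avYOfRecord_mem x hU b) c hg a⟩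

end Record

end Literature.MathematicalPhysics.QuantumFieldTheory.Balaban1983to89.B9PinMemberPivotExact
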